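import Summits.ResolutionOfSingularities.ResolutionOfSingularities.Theorems.WeightedInvariantP3aTieLocus
import Summits.ResolutionOfSingularities.ResolutionOfSingularities.Theorems.WeightedInvariantP3aTieLocusPin
import Summits.ResolutionOfSingularities.ResolutionOfSingularities.Theorems.WeightedInvariantIota3DropCurveB
import HarnessLib

/-!
# (D-b³-curve) OR THE TIE LOCUS, in the `ι₃ᵗ` currency and for every presentation of the filtration
# (door `HypersurfaceCentreConstruction`, stmt-ResolutionOfSingularities-19897; residual (D-b³-curve-FRAC-TIE) of `stub_keyRungGrHomLE_three`)

Topic: `Summits/ResolutionOfSingularities/ResolutionOfSingularities/Theorems`. Helper for the door item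
`HypersurfaceCentreConstruction` (statement `stmt-ResolutionOfSingularities-19897`, route `WeightedInvariant`), line `local-engine`,
def-free.  Sequel of `…P3aTieLocus` (`LocalGameEFTCylinder.notMem_pow_transform_or_tieLocus`: at a successor over the special point of
the P3a cylinder move the order drops unless the successor lies on a tie curve whose tie ideal contains `f`) and of hand -7's
`…Iota3DropCurveB` (`Iota3.dropb3_curve_of_tieFree_datum`, the tie-free case in the (D-b³) binder shape):

* **`Iota3.dropb_curve_or_tieLocus_aux`** — carrier transport to the extended Rees algebra of ANY filtration equal to `𝒥((y,x);(r,q))`, with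
  the tie curves in INTRINSIC terms (`y − λx^r = (t⁻¹)^r W`, `W ∈ 𝔫`; `x = (t⁻¹)^q X'` forces `X' ∉ 𝔫`; the cofactors are unique, `B` a domain);
* `LocalGameEFTCylinder.isRegularLocalRing_of_tieCurve` / `…_of_X_mem` — the pinned successor rings `(t⁻¹, z, Y − λX^r)`, `(t⁻¹, z, X)` of
  …P3aTieLocusPin are regular local THREEFOLDS with those regular systems of parameters;
* **`Iota3.dropb3_curve_or_tieLocus`** — for EVERY family `(u, w)` presenting the filtration, in the binder shape of (D-b³) /
  `hCURVEFRACTIE` of `keyRungGrHomLE_three_of_tieDescent_point_curveFracTie`: at every successor `𝔫` over the closed point off the vertex,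
  `iotaFlatT (B_𝔫) (g/1) < iotaFlatT S f` OR `𝔫` lies on the tie locus of a tie ideal containing `f`;
* **`Iota3.dropb_curve_or_tiePoint_aux`**, **`Iota3.dropb3_curve_or_tiePoint`** — the same with the `t`-HOMOGENEITY binder USED (the PIN of
  …P3aTieLocusPin): `ι₃ᵗ` drops OR `𝔫 = (t⁻¹, z, W)` is the generic point of a tie curve whose tie ideal contains `f` (resp. `(t⁻¹, z, X)` when
  `q = r = 1`), a regular local threefold with regular system of parameters `(t⁻¹, z, W)/1`.

Use (CURVE-TIE.md §4 (i)): applied to the integer-contact datum `(y, x; b, 1)` of a fractional-slope curve centre (`q = 1 ≤ b = r`), the residual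
(D-b³-curve-FRAC-TIE) is now CONFINED to the successors on the curves `Y = λX^b` (`X ∉ 𝔫`) with `f ∈ 𝒥_{(b+1)ν}((x, y − λx^b, z); (1, b+1, 1))`
(and, for `b = 1`, on `X = 0` with `f ∈ 𝒥_{2ν}((y,x,z);(1,2,1))`) — the `x`-chart (resp. `y`-chart) positions where the `σ`-comparison of
CURVE-TIE.md §3 remains to be made.
[OURS · L1 W4.3 · (D-b³-curve-FRAC-TIE) sub-size (i)]  Replaces the role of NO printed item; NOT a statement of the manuscript under review
[claim: Hironaka2017, status: under-review]; candidates stay candidates; AI work, weaker than expert review.  No definition; no axiom.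

## References

* D. Abramovich, M. H. Quek, B. Schober, arXiv:2507.01232 (v3, 2026), Thm 1.3 (3), §5. [AbramovichQuekSchober2025]
* J. Włodarczyk, *Functorial resolution by torus actions*, arXiv:2203.03090, §2.3.9, Def. 2.3.5. [Wlodarczyk2022]
-/

noncomputable section

open IsLocalRing Literature.AlgebraicGeometry.Resolution
open Summit.ResolutionOfSingularities.ResolutionOfSingularities.Theorems
open Summit.ResolutionOfSingularities.ResolutionOfSingularities.Cruxes.HypersurfaceCentreConstruction.LocalEngine

set_option linter.dupNamespace false -- mandated namespace of this single-conjunct summit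

namespace Summit.ResolutionOfSingularities.ResolutionOfSingularities.Theorems

namespace LocalGameEFTCylinder

/-! ### The pinned successor rings on the two tie loci are regular local threefolds -/

section PinReg

variable {S : Type} [CommRing S] [IsRegularLocalRing S] {y x z : S} {r q : ℕ}

/-- **On the tie curve `Y = λX^r`: the pinned successor ring `B_𝔫`, `𝔫 = (t⁻¹, z, Y - λX^r)`, is a regular local threefold with regular system of
parameters `(t⁻¹, z, Y - λX^r)/1`.** [OURS · L1 W4.3 · (D-b³-curve-FRAC-TIE) (i)] [cite: Wlodarczyk2022, §2.3.9] -/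
theorem isRegularLocalRing_of_tieCurve (hyxz : Ideal.span (Set.range ![y, x, z]) = maximalIdeal S)
    (hd : (maximalIdeal S).spanFinrank = 3) [hP : (Ideal.span (Set.range ![y, x])).IsPrime] (hq : 0 < q) (hqr : q ≤ r)
    (𝔫 : Ideal (extReesAlgebra (weightedMonomialIdeal ![y, x] ![r, q]))) [𝔫.IsPrime]
    (hhom : IsTHomogeneous ![y, x] ![r, q] 𝔫)
    (hT : extReesAlgebra.tInv (weightedMonomialIdeal ![y, x] ![r, q]) ∈ 𝔫) (hz : algebraMap S _ z ∈ 𝔫)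
    {lam : S} (hlq : lam = 0 ∨ q = 1)
    (hW : LocalGameEFTPointMove.uT ![y, x] ![r, q] 0 -
      algebraMap S _ lam * LocalGameEFTPointMove.uT ![y, x] ![r, q] 1 ^ r ∈ 𝔫)
    (hXn : LocalGameEFTPointMove.uT ![y, x] ![r, q] 1 ∉ 𝔫) :
    IsRegularLocalRing (Localization.AtPrime 𝔫) ∧ ringKrullDim (Localization.AtPrime 𝔫) = (3 : ℕ) ∧
      Ideal.span {algebraMap _ (Localization.AtPrime 𝔫) (extReesAlgebra.tInv (weightedMonomialIdeal ![y, x] ![r, q])),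
        algebraMap _ (Localization.AtPrime 𝔫) (algebraMap S (extReesAlgebra (weightedMonomialIdeal ![y, x] ![r, q])) z),
        algebraMap _ (Localization.AtPrime 𝔫) (LocalGameEFTPointMove.uT ![y, x] ![r, q] 0 -
          algebraMap S _ lam * LocalGameEFTPointMove.uT ![y, x] ![r, q] 1 ^ r)} =
        maximalIdeal (Localization.AtPrime 𝔫) :=
  isRegularLocalRing_of_eq_span_triple hyxz hd hq hqr 𝔫 Fin.zero_ne_one (lam := lam) (m := r)
    (fun ρ₀ hX hC => by rw [map_sub, map_mul, map_pow, hX, hX, hC])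
    (eq_span_triple_of_isTHomogeneous_of_tieCurve hyxz hd hq hqr 𝔫 hhom hT hz hlq hW hXn)

/-- **On the curve `X = 0`: the pinned successor ring `B_𝔫`, `𝔫 = (t⁻¹, z, X)`, is a regular local threefold with regular system of parameters
`(t⁻¹, z, X)/1`.** [OURS · L1 W4.3 · (D-b³-curve-FRAC-TIE) (i)] [cite: Wlodarczyk2022, §2.3.9] -/
theorem isRegularLocalRing_of_X_mem (hyxz : Ideal.span (Set.range ![y, x, z]) = maximalIdeal S)
    (hd : (maximalIdeal S).spanFinrank = 3) [hP : (Ideal.span (Set.range ![y, x])).IsPrime] (hq : 0 < q) (hqr : q ≤ r)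
    (𝔫 : Ideal (extReesAlgebra (weightedMonomialIdeal ![y, x] ![r, q]))) [𝔫.IsPrime]
    (hhom : IsTHomogeneous ![y, x] ![r, q] 𝔫)
    (hT : extReesAlgebra.tInv (weightedMonomialIdeal ![y, x] ![r, q]) ∈ 𝔫) (hz : algebraMap S _ z ∈ 𝔫)
    (hXmem : LocalGameEFTPointMove.uT ![y, x] ![r, q] 1 ∈ 𝔫) (hYn : LocalGameEFTPointMove.uT ![y, x] ![r, q] 0 ∉ 𝔫) :
    IsRegularLocalRing (Localization.AtPrime 𝔫) ∧ ringKrullDim (Localization.AtPrime 𝔫) = (3 : ℕ) ∧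
      Ideal.span {algebraMap _ (Localization.AtPrime 𝔫) (extReesAlgebra.tInv (weightedMonomialIdeal ![y, x] ![r, q])),
        algebraMap _ (Localization.AtPrime 𝔫) (algebraMap S (extReesAlgebra (weightedMonomialIdeal ![y, x] ![r, q])) z),
        algebraMap _ (Localization.AtPrime 𝔫) (LocalGameEFTPointMove.uT ![y, x] ![r, q] 1)} =
        maximalIdeal (Localization.AtPrime 𝔫) :=
  isRegularLocalRing_of_eq_span_triple hyxz hd hq hqr 𝔫 (Fin.zero_ne_one (n := 0)).symm (lam := 0) (m := 0)
    (fun ρ₀ hX _ => by rw [hX, map_zero, map_zero, zero_mul, sub_zero])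
    (eq_span_triple_of_isTHomogeneous_of_X_mem hyxz hd hq hqr 𝔫 hhom hT hz hXmem hYn)

end PinReg

end LocalGameEFTCylinder

end Summit.ResolutionOfSingularities.ResolutionOfSingularities.Theorems

namespace Summit.ResolutionOfSingularities.ResolutionOfSingularities.Cruxes.HypersurfaceCentreConstruction.LocalEngine

namespace Iota3

/-- Carrier transport (pattern of `Iota3.dropb_curve_of_tieFree_datum_aux`): the tie locus on the extended Rees algebra of ANY filtration `I`
EQUAL to `𝒥((y,x);(r,q))`, in the `ι₃ᵗ` currency and in INTRINSIC terms — the curve `Y - λX^r ∈ 𝔫 ∌ X` is expressed through the local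
equations `y - λx^r = (t⁻¹)^r W`, `x = (t⁻¹)^q X'` (the cofactors are unique, `B` being a domain). [OURS · L1 W4.3 · seam] -/
theorem dropb_curve_or_tieLocus_aux {S : Type} [CommRing S] [IsRegularLocalRing S] {y x z : S} {q r ν : ℕ} {f : S}
    (hyxz : Ideal.span (Set.range ![y, x, z]) = maximalIdeal S) (hd : (maximalIdeal S).spanFinrank = 3)
    [hP : (Ideal.span (Set.range ![y, x])).IsPrime] (hq : 0 < q) (hqr : q ≤ r) (hcop : Nat.Coprime r q) (hν : 1 ≤ ν)
    (hfν0 : f ∈ maximalIdeal S ^ ν) (hfν : f ∉ maximalIdeal S ^ (ν + 1))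
    (hadm : f ∈ weightedMonomialIdeal ![y, x] ![r, q] (r * ν))
    {I : ℕ → Ideal S} (hI : I = weightedMonomialIdeal ![y, x] ![r, q]) (P : Ideal S) :
    ∀ (𝔫 : Ideal (extReesAlgebra I)) [𝔫.IsPrime], extReesAlgebra.tInv I ∈ 𝔫 →
      P.map (algebraMap S (extReesAlgebra I)) ≤ 𝔫 →
      ¬ extReesAlgebra.vertexIdeal I ≤ 𝔫 →
      maximalIdeal S ≤ 𝔫.comap (algebraMap S (extReesAlgebra I)) →
      ∀ (a : ℕ) (g : extReesAlgebra I),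
        algebraMap S (extReesAlgebra I) f = extReesAlgebra.tInv I ^ a * g →
        ¬ extReesAlgebra.tInv I ∣ g →
        iotaFlatT (Localization.AtPrime 𝔫) (algebraMap (extReesAlgebra I) (Localization.AtPrime 𝔫) g) < iotaFlatT S f ∨
        (∃ lam : S, (lam = 0 ∨ q = 1) ∧
          f ∈ weightedMonomialIdeal ![x, y - lam * x ^ r, z] ![q, r + 1, 1] ((r + 1) * ν) ∧
          (∃ W ∈ 𝔫, algebraMap S (extReesAlgebra I) (y - lam * x ^ r) = extReesAlgebra.tInv I ^ r * W) ∧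
          ∀ X' : extReesAlgebra I, algebraMap S (extReesAlgebra I) x = extReesAlgebra.tInv I ^ q * X' → X' ∉ 𝔫) ∨
        (q = 1 ∧ r = 1 ∧ f ∈ weightedMonomialIdeal ![y, x, z] ![1, 2, 1] (2 * ν) ∧
          (∃ X' ∈ 𝔫, algebraMap S (extReesAlgebra I) x = extReesAlgebra.tInv I ^ q * X') ∧
          ∀ W : extReesAlgebra I, algebraMap S (extReesAlgebra I) y = extReesAlgebra.tInv I ^ r * W → W ∉ 𝔫) := by
  subst hI
  haveI := isDomain_of_isRegularLocalRing S
  have hν' : (ν : Ordinal.{0}) ≤ iotaOrd S f := (natCast_le_iotaOrd_iff S f ν).mpr hfν0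
  intro 𝔫 _ hT _ hV hM a g hfg hTg
  have hz : algebraMap S _ z ∈ 𝔫 := hM (hyxz ▸ Ideal.subset_span ⟨2, rfl⟩)
  rcases LocalGameEFTCylinder.notMem_pow_transform_or_tieLocus hyxz hd hq hqr hcop hν hfν hadm 𝔫 hT hz hV hfg hTg with
      h | ⟨lam, hlq, hft, hW, hX⟩ | ⟨hq1, hr1, hft, hX, hY⟩
  · exact Or.inl (iotaFlatT_lt_of_iotaOrd_lt _ _ _ _
      (lt_of_lt_of_le (LocalGameEFTFace.iotaOrd_lt_of_notMem_pow h) hν'))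
  · refine Or.inr (Or.inl ⟨lam, hlq, hft, ⟨_, hW, LocalGameEFTCylinder.algebraMap_y_sub_eq hlq⟩, fun X' hX' => ?_⟩)
    rw [LocalGameEFTCylinder.eq_uT_one_of_algebraMap_x_eq hX']
    exact hX
  · refine Or.inr (Or.inr ⟨hq1, hr1, hft, ⟨_, hX, LocalGameEFTCylinder.algebraMap_x_eq⟩, fun W hW => ?_⟩)
    rw [LocalGameEFTCylinder.eq_uT_zero_of_algebraMap_y_eq hW]
    exact hY

/-- **(D-b³-curve) OR THE TIE LOCUS, for EVERY presentation of the filtration, in the binder shape of (D-b³).**  `S` regular local with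
regular system of parameters `(y, x, z)` (`spanFinrank 𝔪 = 3`), `(y, x)` prime, coprime weights `0 < q ≤ r`, `ν ≥ 1`,
`f ∈ 𝒥_{rν}((y,x);(r,q)) ∩ 𝔪^ν ∖ 𝔪^{ν+1}`; `(u, w)` ANY family with `weightedMonomialIdeal u w m = 𝒥ₘ((y,x);(r,q))` for all `m`.  At every
successor prime `𝔫` of `cobordantAlgebra' u w` over the closed point (`t⁻¹ ∈ 𝔫`, `𝔪_S B ≤ 𝔫`, off the vertex) and every `f = (t⁻¹)ᵃ g`, `t⁻¹ ∤ g`: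
EITHER `iotaFlatT (B_𝔫) (g/1) < iotaFlatT S f`, OR `𝔫` lies on a tie curve `Y = λX^r`, `X ∉ 𝔫` (`λ = 0` or `q = 1`) with
`f ∈ 𝒥_{(r+1)ν}((x, y − λx^r, z); (q, r+1, 1))`, OR (`q = r = 1`) on `X = 0`, `Y ∉ 𝔫`, with `f ∈ 𝒥_{2ν}((y,x,z);(1,2,1))` — the curves in
intrinsic terms (`y − λx^r = (t⁻¹)^r W` with `W ∈ 𝔫`; `x = (t⁻¹)^q X'` forces `X' ∉ 𝔫`).  The `t`-homogeneity and `g/1 ∈ 𝔪_𝔫²` binders are not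
used.  `Iota3.dropb3_curve_of_tieFree_datum` is the tie-free special case. [OURS · L1 W4.3 · (D-b³-curve-FRAC-TIE) (i)]
[cite: AbramovichQuekSchober2025, Thm 1.3 (3)] -/
theorem dropb3_curve_or_tieLocus {S : Type} [CommRing S] [IsRegularLocalRing S] {y x z : S} {q r ν : ℕ} {f : S}
    (hyxz : Ideal.span (Set.range ![y, x, z]) = maximalIdeal S) (hd : (maximalIdeal S).spanFinrank = 3)
    [hP : (Ideal.span (Set.range ![y, x])).IsPrime] (hq : 0 < q) (hqr : q ≤ r) (hcop : Nat.Coprime r q) (hν : 1 ≤ ν)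
    (hfν0 : f ∈ maximalIdeal S ^ ν) (hfν : f ∉ maximalIdeal S ^ (ν + 1))
    (hadm : f ∈ weightedMonomialIdeal ![y, x] ![r, q] (r * ν))
    {n : ℕ} (u : Fin n → S) (w : Fin n → ℕ) (hpres : ∀ m : ℕ, weightedMonomialIdeal u w m = weightedMonomialIdeal ![y, x] ![r, q] m) :
    ∀ (𝔫 : Ideal (cobordantAlgebra' u w)) [𝔫.IsPrime], IsTHomogeneous u w 𝔫 → cobordantT' u w ∈ 𝔫 →
      (maximalIdeal S).map (algebraMap S (cobordantAlgebra' u w)) ≤ 𝔫 →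
      ¬ extReesAlgebra.vertexIdeal (weightedMonomialIdeal u w) ≤ 𝔫 →
      ∀ (a : ℕ) (g : cobordantAlgebra' u w), algebraMap S (cobordantAlgebra' u w) f = cobordantT' u w ^ a * g →
        ¬ cobordantT' u w ∣ g →
        algebraMap (cobordantAlgebra' u w) (Localization.AtPrime 𝔫) g ∈ maximalIdeal (Localization.AtPrime 𝔫) ^ 2 →
        iotaFlatT (Localization.AtPrime 𝔫) (algebraMap (cobordantAlgebra' u w) (Localization.AtPrime 𝔫) g) < iotaFlatT S f ∨
        (∃ lam : S, (lam = 0 ∨ q = 1) ∧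
          f ∈ weightedMonomialIdeal ![x, y - lam * x ^ r, z] ![q, r + 1, 1] ((r + 1) * ν) ∧
          (∃ W ∈ 𝔫, algebraMap S (cobordantAlgebra' u w) (y - lam * x ^ r) = cobordantT' u w ^ r * W) ∧
          ∀ X' : cobordantAlgebra' u w, algebraMap S (cobordantAlgebra' u w) x = cobordantT' u w ^ q * X' → X' ∉ 𝔫) ∨
        (q = 1 ∧ r = 1 ∧ f ∈ weightedMonomialIdeal ![y, x, z] ![1, 2, 1] (2 * ν) ∧
          (∃ X' ∈ 𝔫, algebraMap S (cobordantAlgebra' u w) x = cobordantT' u w ^ q * X') ∧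
          ∀ W : cobordantAlgebra' u w, algebraMap S (cobordantAlgebra' u w) y = cobordantT' u w ^ r * W → W ∉ 𝔫) := by
  intro 𝔫 _ _ hT hM hV a g hfg hTg _
  exact dropb_curve_or_tieLocus_aux hyxz hd hq hqr hcop hν hfν0 hfν hadm (funext hpres) (maximalIdeal S) 𝔫 hT hM hV
    (Ideal.map_le_iff_le_comap.mp hM) a g hfg hTg

/-- Carrier transport for the PINNED form: on the extended Rees algebra of ANY filtration `I` equal to `𝒥((y,x);(r,q))`, at a `t`-HOMOGENEOUS
successor over the closed point (homogeneity stated through `KWildHom.tPiece (extReesAlgebra I)`, definitionally `IsTHomogeneous` for a presented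
filtration): `ι₃ᵗ` drops, OR `𝔫` IS the generic point `(t⁻¹, z, W)` of a tie curve `y - λx^r = (t⁻¹)^r W` (`λ = 0` or `q = 1`) whose tie ideal
contains `f`, OR (`q = r = 1`) `𝔫 = (t⁻¹, z, X')`, `x = (t⁻¹)^q X'`, with `f ∈ 𝒥_{2ν}((y,x,z);(1,2,1))` — and in the last two cases `B_𝔫` is a
regular local threefold with regular system of parameters `(t⁻¹, z, W)/1` (resp. `(t⁻¹, z, X')/1`). [OURS · L1 W4.3 · seam] -/
theorem dropb_curve_or_tiePoint_aux {S : Type} [CommRing S] [IsRegularLocalRing S] {y x z : S} {q r ν : ℕ} {f : S}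
    (hyxz : Ideal.span (Set.range ![y, x, z]) = maximalIdeal S) (hd : (maximalIdeal S).spanFinrank = 3)
    [hP : (Ideal.span (Set.range ![y, x])).IsPrime] (hq : 0 < q) (hqr : q ≤ r) (hcop : Nat.Coprime r q) (hν : 1 ≤ ν)
    (hfν0 : f ∈ maximalIdeal S ^ ν) (hfν : f ∉ maximalIdeal S ^ (ν + 1))
    (hadm : f ∈ weightedMonomialIdeal ![y, x] ![r, q] (r * ν))
    {I : ℕ → Ideal S} (hI : I = weightedMonomialIdeal ![y, x] ![r, q]) (P : Ideal S) :
    ∀ (𝔫 : Ideal (extReesAlgebra I)) [𝔫.IsPrime],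
      Ideal.span {b | b ∈ 𝔫 ∧ SetLike.IsHomogeneousElem (KWildHom.tPiece (extReesAlgebra I)) b} = 𝔫 →
      extReesAlgebra.tInv I ∈ 𝔫 →
      P.map (algebraMap S (extReesAlgebra I)) ≤ 𝔫 →
      ¬ extReesAlgebra.vertexIdeal I ≤ 𝔫 →
      maximalIdeal S ≤ 𝔫.comap (algebraMap S (extReesAlgebra I)) →
      ∀ (a : ℕ) (g : extReesAlgebra I),
        algebraMap S (extReesAlgebra I) f = extReesAlgebra.tInv I ^ a * g →
        ¬ extReesAlgebra.tInv I ∣ g →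
        iotaFlatT (Localization.AtPrime 𝔫) (algebraMap (extReesAlgebra I) (Localization.AtPrime 𝔫) g) < iotaFlatT S f ∨
        (∃ lam : S, (lam = 0 ∨ q = 1) ∧
          f ∈ weightedMonomialIdeal ![x, y - lam * x ^ r, z] ![q, r + 1, 1] ((r + 1) * ν) ∧
          ∃ W : extReesAlgebra I, algebraMap S (extReesAlgebra I) (y - lam * x ^ r) = extReesAlgebra.tInv I ^ r * W ∧
            𝔫 = Ideal.span {extReesAlgebra.tInv I, algebraMap S (extReesAlgebra I) z, W} ∧
            IsRegularLocalRing (Localization.AtPrime 𝔫) ∧ ringKrullDim (Localization.AtPrime 𝔫) = (3 : ℕ) ∧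
            Ideal.span {algebraMap _ (Localization.AtPrime 𝔫) (extReesAlgebra.tInv I),
              algebraMap _ (Localization.AtPrime 𝔫) (algebraMap S (extReesAlgebra I) z),
              algebraMap _ (Localization.AtPrime 𝔫) W} = maximalIdeal (Localization.AtPrime 𝔫)) ∨
        (q = 1 ∧ r = 1 ∧ f ∈ weightedMonomialIdeal ![y, x, z] ![1, 2, 1] (2 * ν) ∧
          ∃ X' : extReesAlgebra I, algebraMap S (extReesAlgebra I) x = extReesAlgebra.tInv I ^ q * X' ∧
            𝔫 = Ideal.span {extReesAlgebra.tInv I, algebraMap S (extReesAlgebra I) z, X'} ∧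
            IsRegularLocalRing (Localization.AtPrime 𝔫) ∧ ringKrullDim (Localization.AtPrime 𝔫) = (3 : ℕ) ∧
            Ideal.span {algebraMap _ (Localization.AtPrime 𝔫) (extReesAlgebra.tInv I),
              algebraMap _ (Localization.AtPrime 𝔫) (algebraMap S (extReesAlgebra I) z),
              algebraMap _ (Localization.AtPrime 𝔫) X'} = maximalIdeal (Localization.AtPrime 𝔫)) := by
  subst hI
  haveI := isDomain_of_isRegularLocalRing S
  have hν' : (ν : Ordinal.{0}) ≤ iotaOrd S f := (natCast_le_iotaOrd_iff S f ν).mpr hfν0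
  intro 𝔫 _ hhom hT _ hV hM a g hfg hTg
  have hz : algebraMap S _ z ∈ 𝔫 := hM (hyxz ▸ Ideal.subset_span ⟨2, rfl⟩)
  rcases LocalGameEFTCylinder.notMem_pow_transform_or_tieLocus hyxz hd hq hqr hcop hν hfν hadm 𝔫 hT hz hV hfg hTg with
      h | ⟨lam, hlq, hft, hW, hX⟩ | ⟨hq1, hr1, hft, hX, hY⟩
  · exact Or.inl (iotaFlatT_lt_of_iotaOrd_lt _ _ _ _
      (lt_of_lt_of_le (LocalGameEFTFace.iotaOrd_lt_of_notMem_pow h) hν'))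
  · exact Or.inr (Or.inl ⟨lam, hlq, hft, _, LocalGameEFTCylinder.algebraMap_y_sub_eq hlq,
      LocalGameEFTCylinder.eq_span_triple_of_isTHomogeneous_of_tieCurve hyxz hd hq hqr 𝔫 hhom hT hz hlq hW hX,
      LocalGameEFTCylinder.isRegularLocalRing_of_tieCurve hyxz hd hq hqr 𝔫 hhom hT hz hlq hW hX⟩)
  · subst hq1 hr1
    exact Or.inr (Or.inr ⟨rfl, rfl, hft, _, LocalGameEFTCylinder.algebraMap_x_eq,
      LocalGameEFTCylinder.eq_span_triple_of_isTHomogeneous_of_X_mem hyxz hd hq hqr 𝔫 hhom hT hz hX hY,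
      LocalGameEFTCylinder.isRegularLocalRing_of_X_mem hyxz hd hq hqr 𝔫 hhom hT hz hX hY⟩)

/-- **(D-b³-curve) OR A PINNED TIE POINT, for EVERY presentation of the filtration, in the binder shape of (D-b³)** — the `t`-homogeneity binder
is USED: at every `t`-homogeneous successor prime `𝔫` of `cobordantAlgebra' u w` over the closed point off the vertex and every `f = (t⁻¹)ᵃ g`,
`t⁻¹ ∤ g`: EITHER `iotaFlatT (B_𝔫) (g/1) < iotaFlatT S f`, OR `𝔫 = (t⁻¹, z, W)` is the generic point of a tie curve (`y - λx^r = (t⁻¹)^r W`,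
`λ = 0` or `q = 1`) with `f ∈ 𝒥_{(r+1)ν}((x, y − λx^r, z); (q, r+1, 1))`, OR (`q = r = 1`) `𝔫 = (t⁻¹, z, X')` (`x = (t⁻¹)^q X'`) with
`f ∈ 𝒥_{2ν}((y,x,z);(1,2,1))`; in the last two cases `B_𝔫` is a regular local THREEFOLD with regular system of parameters `(t⁻¹, z, W)/1`.
This is the residual (D-b³-curve-FRAC-TIE) of `keyRungGrHomLE_three_of_tieDescent_point_curveFracTie` cut down to ONE explicit regular local
ring per tie ideal containing `f` (CURVE-TIE.md §4 (i) complete; (ii) the `σ`-comparison there and (iii) the torus step remain).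
[OURS · L1 W4.3 · (D-b³-curve-FRAC-TIE) (i)] [cite: AbramovichQuekSchober2025, Thm 1.3 (3)] [cite: Wlodarczyk2022, §2.3.9] -/
theorem dropb3_curve_or_tiePoint {S : Type} [CommRing S] [IsRegularLocalRing S] {y x z : S} {q r ν : ℕ} {f : S}
    (hyxz : Ideal.span (Set.range ![y, x, z]) = maximalIdeal S) (hd : (maximalIdeal S).spanFinrank = 3)
    [hP : (Ideal.span (Set.range ![y, x])).IsPrime] (hq : 0 < q) (hqr : q ≤ r) (hcop : Nat.Coprime r q) (hν : 1 ≤ ν)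
    (hfν0 : f ∈ maximalIdeal S ^ ν) (hfν : f ∉ maximalIdeal S ^ (ν + 1))
    (hadm : f ∈ weightedMonomialIdeal ![y, x] ![r, q] (r * ν))
    {n : ℕ} (u : Fin n → S) (w : Fin n → ℕ) (hpres : ∀ m : ℕ, weightedMonomialIdeal u w m = weightedMonomialIdeal ![y, x] ![r, q] m) :
    ∀ (𝔫 : Ideal (cobordantAlgebra' u w)) [𝔫.IsPrime], IsTHomogeneous u w 𝔫 → cobordantT' u w ∈ 𝔫 →
      (maximalIdeal S).map (algebraMap S (cobordantAlgebra' u w)) ≤ 𝔫 →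
      ¬ extReesAlgebra.vertexIdeal (weightedMonomialIdeal u w) ≤ 𝔫 →
      ∀ (a : ℕ) (g : cobordantAlgebra' u w), algebraMap S (cobordantAlgebra' u w) f = cobordantT' u w ^ a * g →
        ¬ cobordantT' u w ∣ g →
        algebraMap (cobordantAlgebra' u w) (Localization.AtPrime 𝔫) g ∈ maximalIdeal (Localization.AtPrime 𝔫) ^ 2 →
        iotaFlatT (Localization.AtPrime 𝔫) (algebraMap (cobordantAlgebra' u w) (Localization.AtPrime 𝔫) g) < iotaFlatT S f ∨
        (∃ lam : S, (lam = 0 ∨ q = 1) ∧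
          f ∈ weightedMonomialIdeal ![x, y - lam * x ^ r, z] ![q, r + 1, 1] ((r + 1) * ν) ∧
          ∃ W : cobordantAlgebra' u w, algebraMap S (cobordantAlgebra' u w) (y - lam * x ^ r) = cobordantT' u w ^ r * W ∧
            𝔫 = Ideal.span {cobordantT' u w, algebraMap S (cobordantAlgebra' u w) z, W} ∧
            IsRegularLocalRing (Localization.AtPrime 𝔫) ∧ ringKrullDim (Localization.AtPrime 𝔫) = (3 : ℕ) ∧
            Ideal.span {algebraMap _ (Localization.AtPrime 𝔫) (cobordantT' u w),
              algebraMap _ (Localization.AtPrime 𝔫) (algebraMap S (cobordantAlgebra' u w) z),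
              algebraMap _ (Localization.AtPrime 𝔫) W} = maximalIdeal (Localization.AtPrime 𝔫)) ∨
        (q = 1 ∧ r = 1 ∧ f ∈ weightedMonomialIdeal ![y, x, z] ![1, 2, 1] (2 * ν) ∧
          ∃ X' : cobordantAlgebra' u w, algebraMap S (cobordantAlgebra' u w) x = cobordantT' u w ^ q * X' ∧
            𝔫 = Ideal.span {cobordantT' u w, algebraMap S (cobordantAlgebra' u w) z, X'} ∧
            IsRegularLocalRing (Localization.AtPrime 𝔫) ∧ ringKrullDim (Localization.AtPrime 𝔫) = (3 : ℕ) ∧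
            Ideal.span {algebraMap _ (Localization.AtPrime 𝔫) (cobordantT' u w),
              algebraMap _ (Localization.AtPrime 𝔫) (algebraMap S (cobordantAlgebra' u w) z),
              algebraMap _ (Localization.AtPrime 𝔫) X'} = maximalIdeal (Localization.AtPrime 𝔫)) := by
  intro 𝔫 _ hhom hT hM hV a g hfg hTg _
  exact dropb_curve_or_tiePoint_aux hyxz hd hq hqr hcop hν hfν0 hfν hadm (funext hpres) (maximalIdeal S) 𝔫 hhom hT hM hV
    (Ideal.map_le_iff_le_comap.mp hM) a g hfg hTg

end Iota3

end Summit.ResolutionOfSingularities.ResolutionOfSingularities.Cruxes.HypersurfaceCentreConstruction.LocalEngine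

end
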